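/-
Copyright (c) 2026. All rights reserved.
Released under Apache 2.0 license as described in the file LICENSE.
-/
import Summits.Langlands.Langlands.Theorems.SoloInformedTateFamilyPstResidue
import Literature.NumberTheory.GaloisRepresentations.WeilLAdicCharacterLocalShape
import Literature.NumberTheory.Automorphic.AlgebraicityParityGL
import HarnessLib

/-!
# Clause (A) of the summit for `GL₁` in full: Weil's `ℓ`-adic avatar of an algebraic Hecke character

Files Λ12–Λ20 of this programme (`SoloInformedTateFamily*`) settled the summit's clause
(A) = `AutomorphicToGalois 1 𝓡 hcpt` on the Tate family `|·|^k ∘ det`.  This file treats **every**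
`L`-algebraic cuspidal `π` of `GL₁/K`, i.e. every algebraic Hecke character `θ` (infinity type
`(p, q)`), through the tree's sorry-free construction `HasInfinityType.weilRep hinf hmod ι` of
Weil's `ℓ`-adic character `r_{θ,ι} : Γ_K → GL₁(ℚ̄_ℓ)` [Weil 1956 §§1–2; Serre II §2.7–2.8].

* §1 rank-one Grothendieck–Deligne dictionary: a rank-one Weil–Deligne representation has `N = 0`,
  so any `(r, N)` attached to `ρW : W_F → GL₁(E)` by `IsWeilDeligneOfLadic` has `r = ρW` on all of
  `W_F` [Deligne, Antwerp II §8.4.2; Tate, Corvallis (4.2.1)].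
* §2 for every automorphic `π` of `GL₁/K` on which the ideles act through `θ ∘ det` modulo `π.W'`,
  `(π, r_{θ,ι})` is Satake–Frobenius compatible a.e., and (Λ16: strong multiplicity one +
  Chebotarev) a framed `ρ` is Satake-compatible with `π` a.e. **iff** `ρ = r_{θ,ι}` — the Galois
  partner in clause (A) is known and unique; `weilRep` is independent of its witnesses.
* §3 at every `v ∤ ℓ`, ramified or not, `r_{θ,ι} ∘ Art_v = ι⁻¹ ∘ θ_v` on `W_{K_v}`.
* §4 the local component of such a `π` at `v` is `θ_v ∘ det` [Flath 1979, Thm 3], and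
  `LocalGlobalCompatibleAt 𝓡 ι π r_{θ,ι} v` holds at **every** `v ∤ ℓ`, ramified places included
  [Harris–Taylor 2001, Thm A for `n = 1` = local class field theory].
* §5 ★ `automorphicToGalois_one_iff_pst`: **clause (A) for `n = 1` is equivalent to a statement
  about the pinned Fontaine datum alone** — for all algebraic `θ`, all `ℓ, ι`, `v ∣ ℓ`, the datum
  `𝓡.pst ℓ v _ = fontainePstAdicCompletion v ℓ _` (i) declares `r_{θ,ι}|Γ_{K_v}` de Rham and
  (ii) attaches to it a Weil–Deligne representation whose `ι`-transport has class
  `rec₁(θ_v ∘ det) = [(θ_v ∘ Art_v, N = 0)]` (`recGL_one_ofQuasiChar`, Λ19).  Everything else in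
  (A) for `GL₁` is PROVED here.

(i) is the named fact `HeckeCharacter.isDeRham_lAdicRep_of_hasInfinityType` [Serre III §2.3;
Conrad, App. B.4], reduced in-tree to `(PU)+(LT)` (`WeilLAdicCharacterDeRhamReduction`); (ii) is
the expected value of `D_pst` on a locally algebraic character [Fontaine, Astérisque 223 VIII
§2.3.7; Buzzard–Gee Conj. 3.2.2, Rem. 3.2.5].  Neither is decided by the interface
`IsFontaineDatum` for characters ramified at `v ∣ ℓ` ((F5)/(F7) cover locally unramified input
only), so for `GL₁` clause (A) *is* the right-hand side of §5: a property of the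
`Classical.epsilon`-pinned datum on Weil's characters, not of automorphic forms.

Citations: [Weil1956] §§1–2; [SerreAbelianLadic1968] I §2.3, II §2.7–2.8, III §2.3;
[TateCorvallis1979] (4.1.3)–(4.2.1); [DeligneAntwerpII1973] §8.4.2; [Flath1979] Thm 3;
[BorelJacquet1979] §4.6; [HarrisTaylorAMS2001] Thm A; [BuzzardGeeLMS2014] Conj. 3.2.1–3.2.2,
Rem. 3.2.5; [TaylorGaloisRepresentations2004] Conj. 7; [FontaineAsterisque223VIII] §2.3.7;
[FontaineMazurGeometric1995] §1; [Conrad2011LiftingGlobal] App. B.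
-/

noncomputable section

open scoped MatrixGroups Matrix Classical Polynomial NumberField
open NumberField IsDedekindDomain Field Polynomial Filter
open Literature.NumberTheory.Automorphic Literature.NumberTheory.GaloisRepresentations

namespace Summit.Langlands.Langlands.Theorems

namespace GLOneRigidity

/-! ### §1 The rank-one Grothendieck–Deligne dictionary -/

section RankOne

variable {F : Type*} [Field F] [ValuativeRel F] [TopologicalSpace F] [IsNonarchimedeanLocalField F]
  {E : Type*} [Field E] [CharZero E]

/-- A rank-one Weil–Deligne representation has `N = 0`. [cite: DeligneAntwerpII1973, §8.4.2] -/
theorem weilDeligneRep_N_eq_zero_of_rank_one (r : WeilDeligneRep F E (Fin 1 → E)) : r.N = 0 := by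
  have hNnil : IsNilpotent (LinearMap.toMatrix' r.N) :=
    r.isNilpotent_N.map LinearMap.toMatrixAlgEquiv'
  obtain ⟨k, hk⟩ := hNnil
  have h00 : LinearMap.toMatrix' r.N 0 0 = 0 := by
    refine IsNilpotent.eq_zero ⟨k, ?_⟩
    rw [← Matrix.det_fin_one (LinearMap.toMatrix' r.N), ← Matrix.det_pow, hk, Matrix.det_zero]
  have hmat : LinearMap.toMatrix' r.N = 0 := by
    ext i j
    obtain rfl : i = 0 := Subsingleton.elim _ _
    obtain rfl : j = 0 := Subsingleton.elim _ _
    rw [h00, Matrix.zero_apply]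
  exact (LinearEquiv.map_eq_zero_iff LinearMap.toMatrix').mp hmat

/-- **Rank-one Grothendieck–Deligne dictionary.**  If `(r, N)` is attached to
`ρW : W_F → GL₁(E)` (`IsWeilDeligneOfLadic ρW r`: `ρW = exp(t·N)` on an open subgroup of
inertia and `r(Φ^m u) = ρW(Φ^m u)·exp(-t(u)N)`), then `N = 0` forces `r = ρW` on the whole Weil
group — no unramifiedness needed. [cite: DeligneAntwerpII1973, §8.4.2]
[cite: TateCorvallis1979, (4.2.1)] -/
theorem isWeilDeligneOfLadic_toMatrix'_ρ_eq_of_rank_one {ρW : WeilGroup F →* GL (Fin 1) E}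
    {r : WeilDeligneRep F E (Fin 1 → E)} (h : IsWeilDeligneOfLadic ρW r) (w : WeilGroup F) :
    LinearMap.toMatrix' (r.ρ w) = ((ρW w : GL (Fin 1) E) : Matrix (Fin 1) (Fin 1) E) := by
  have hN : r.N = 0 := weilDeligneRep_N_eq_zero_of_rank_one r
  obtain ⟨t, U, Φ, -, -, hΦ, -, -, h3⟩ := h
  have hmem : Φ ^ (WeilGroup.deg w) * w ∈ WeilGroup.inertia F :=
    WeilGroup.zpow_deg_mul_mem_inertia hΦ w
  have key := h3 (-WeilGroup.deg w) ⟨Φ ^ (WeilGroup.deg w) * w, hmem⟩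
  have hw : Φ ^ (-WeilGroup.deg w) * (Φ ^ (WeilGroup.deg w) * w) = w := by
    rw [← mul_assoc, zpow_neg, inv_mul_cancel, one_mul]
  simp only [hw, hN, map_zero, smul_zero, neg_zero, IsNilpotent.exp_zero, mul_one] at key
  exact key

end RankOne

/-! ### §2 Satake compatibility and rigidity: the Galois partner of `π` is `r_{θ,ι}` -/

section Avatar

variable {K : Type} [Field K] [NumberField K] {hcpt : isCompact_glFiniteIntegralLevel 1 K}
  {ℓ : ℕ} [Fact ℓ.Prime] {θ : HeckeCharacter K} {p q : InfinitePlace K → ℤ}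
  {T : Finset (HeightOneSpectrum (𝓞 K))} {e : HeightOneSpectrum (𝓞 K) → ℕ}

/-- **Satake–Frobenius compatibility of `(π, r_{θ,ι})` almost everywhere.**  If the ideles act on
`π` through `θ ∘ det` modulo `π.W'`, then at every `v ∉ T`, `v ∤ ℓ` at which `π` has Satake
parameter `{θ_v(ϖ_v)}` (almost all `v`, by `eventually_hasSatakeParamAt_glOne`), `r_{θ,ι}` is
unramified with `char(Frob_v) = X - ι⁻¹(θ_v(ϖ_v))⁻¹ = arithFrobPolyOfSatake ι q_v 1 {θ_v(ϖ_v)}`.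
[cite: Weil1956, §1] [cite: SerreAbelianLadic1968, II §2.8]
[cite: BuzzardGeeLMS2014, Conj. 3.2.1] -/
theorem eventually_satakeFrobCompatibleAt_weilRep (ι : PadicAlgCl ℓ ≃+* ℂ)
    (π : AutomorphicRepData (AutomorphyDatum.gl 1 K hcpt))
    (hχ : ∀ (g : (AdelicGroupData.gl 1 K).Adelic), ∀ φ ∈ π.W,
      rightTranslation (AdelicGroupData.gl 1 K) g φ -
        ((θ (Matrix.GeneralLinearGroup.det g) : ℂˣ) : ℂ) • φ ∈ π.W')
    (hinf : θ.HasInfinityType p q) (hmod : HeckeCharacter.IsModulus θ T e) :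
    ∀ᶠ v : HeightOneSpectrum (𝓞 K) in cofinite,
      SatakeFrobCompatibleAt ι π (hinf.weilRep hmod ι) v := by
  have hℓ : ∀ᶠ v : HeightOneSpectrum (𝓞 K) in cofinite, ((ℓ : ℕ) : 𝓞 K) ∉ v.asIdeal :=
    Literature.RingTheory.DedekindDomain.eventually_not_mem_asIdeal
      (Nat.cast_ne_zero.mpr (Fact.out : ℓ.Prime).ne_zero)
  filter_upwards [π.eventually_hasSatakeParamAt_glOne hχ, T.eventually_cofinite_notMem, hℓ]
    with v hv hvT hvℓ
  refine ⟨{θ.valueAtUniformizer v}, hv _ (HeckeCharacter.valued_uniformizer v),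
    hinf.isUnramifiedAt_weilRep hmod ι hvT hvℓ, ?_⟩
  rw [D2Cris.arithFrobPolyOfSatake_one_singleton]
  exact hinf.hasFrobCharpolyAt_weilRep hmod ι hvT hvℓ

/-- **Rigidity: the Galois partner is Weil's character.**  A framed `ρ : Γ_K → GL₁(ℚ̄_ℓ)` is
Satake–Frobenius compatible with such a `π` at almost all `v` iff `ρ = r_{θ,ι}` (strong
multiplicity one + Chebotarev, Λ16 `eq_of_eventually_satakeFrobCompatibleAt`).
[cite: SerreAbelianLadic1968, I §2.3] [cite: TaylorGaloisRepresentations2004, §1] -/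
theorem eventually_satakeFrobCompatibleAt_iff_eq_weilRep (ι : PadicAlgCl ℓ ≃+* ℂ)
    (π : AutomorphicRepData (AutomorphyDatum.gl 1 K hcpt))
    (hχ : ∀ (g : (AdelicGroupData.gl 1 K).Adelic), ∀ φ ∈ π.W,
      rightTranslation (AdelicGroupData.gl 1 K) g φ -
        ((θ (Matrix.GeneralLinearGroup.det g) : ℂˣ) : ℂ) • φ ∈ π.W')
    (hinf : θ.HasInfinityType p q) (hmod : HeckeCharacter.IsModulus θ T e)
    (ρ : FramedGaloisRep K (PadicAlgCl ℓ) 1) :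
    (∀ᶠ v : HeightOneSpectrum (𝓞 K) in cofinite, SatakeFrobCompatibleAt ι π ρ v) ↔
      ρ = hinf.weilRep hmod ι := by
  refine ⟨fun h => eq_of_eventually_satakeFrobCompatibleAt ι π h
    (eventually_satakeFrobCompatibleAt_weilRep ι π hχ hinf hmod), fun h => ?_⟩
  subst h
  exact eventually_satakeFrobCompatibleAt_weilRep ι π hχ hinf hmod

/-- In clause (A) for `GL₁`, a `ρ` that `Corresponds` to `π` **is** `r_{θ,ι}`.
[cite: BuzzardGeeLMS2014, Conj. 3.2.2] -/
theorem eq_weilRep_of_corresponds (𝓡 : ReciprocityData K) (ι : PadicAlgCl ℓ ≃+* ℂ)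
    (π : AutomorphicRepData (AutomorphyDatum.gl 1 K hcpt))
    (hχ : ∀ (g : (AdelicGroupData.gl 1 K).Adelic), ∀ φ ∈ π.W,
      rightTranslation (AdelicGroupData.gl 1 K) g φ -
        ((θ (Matrix.GeneralLinearGroup.det g) : ℂˣ) : ℂ) • φ ∈ π.W')
    (hinf : θ.HasInfinityType p q) (hmod : HeckeCharacter.IsModulus θ T e)
    {ρ : FramedGaloisRep K (PadicAlgCl ℓ) 1} (h : Corresponds 𝓡 ι π ρ) :
    ρ = hinf.weilRep hmod ι :=
  (eventually_satakeFrobCompatibleAt_iff_eq_weilRep ι π hχ hinf hmod ρ).mp h.1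

/-- `weilRep` does not depend on the witnesses `(p, q, hinf)`, `(T, e, hmod)` (rigidity through the
automorphic `θ ∘ det`). [cite: SerreAbelianLadic1968, II §2.7] [cite: BorelJacquet1979, §4.6] -/
theorem weilRep_eq_weilRep (ι : PadicAlgCl ℓ ≃+* ℂ) (hinf : θ.HasInfinityType p q)
    (hmod : HeckeCharacter.IsModulus θ T e) {p' q' : InfinitePlace K → ℤ}
    (hinf' : θ.HasInfinityType p' q') {T' : Finset (HeightOneSpectrum (𝓞 K))}
    {e' : HeightOneSpectrum (𝓞 K) → ℕ} (hmod' : HeckeCharacter.IsModulus θ T' e') :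
    hinf.weilRep hmod ι = hinf'.weilRep hmod' ι := by
  obtain ⟨π, hW, -⟩ :=
    exists_cuspidal_detTwist_glOne (isCompact_glFiniteIntegralLevel_holds (n := 1) (K := K)) θ
  exact (eventually_satakeFrobCompatibleAt_iff_eq_weilRep ι π.1 (heckeCharacter_detTwist_glOne hW)
    hinf' hmod' _).mp
    (eventually_satakeFrobCompatibleAt_weilRep ι π.1 (heckeCharacter_detTwist_glOne hW) hinf hmod)

/-- `r_{θ,ι}` is `IsGeometricFramed` iff the pinned datum declares it de Rham at every `v ∣ ℓ`
(unramifiedness a.e. is proved). [cite: FontaineMazurGeometric1995, §1] -/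
theorem isGeometricFramed_weilRep_iff (𝓡 : ReciprocityData K) (ι : PadicAlgCl ℓ ≃+* ℂ)
    (hinf : θ.HasInfinityType p q) (hmod : HeckeCharacter.IsModulus θ T e) :
    IsGeometricFramed 𝓡 (hinf.weilRep hmod ι) ↔
      ∀ (v : HeightOneSpectrum (𝓞 K)) (hv : ((ℓ : ℕ) : 𝓞 K) ∈ v.asIdeal),
        (𝓡.pst ℓ v hv).IsDeRhamFramed ((hinf.weilRep hmod ι).toLocal v) := by
  have hℓ : ∀ᶠ v : HeightOneSpectrum (𝓞 K) in cofinite, ((ℓ : ℕ) : 𝓞 K) ∉ v.asIdeal :=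
    Literature.RingTheory.DedekindDomain.eventually_not_mem_asIdeal
      (Nat.cast_ne_zero.mpr (Fact.out : ℓ.Prime).ne_zero)
  have hunr : ∀ᶠ v : HeightOneSpectrum (𝓞 K) in cofinite,
      (hinf.weilRep hmod ι).IsUnramifiedAt v := by
    filter_upwards [T.eventually_cofinite_notMem, hℓ] with v hvT hvℓ
    exact hinf.isUnramifiedAt_weilRep hmod ι hvT hvℓ
  exact ⟨fun h => h.2, fun h => ⟨hunr, h⟩⟩

/-! ### §3 Weil's character on the local Weil groups away from `ℓ` -/

/-- **`r_{θ,ι} ∘ Art_v = ι⁻¹ ∘ θ_v` on `W_{K_v}` for every `v ∤ ℓ`** (ramified `v` included), via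
the tree's `det_weilRep_toAbsGalois` (at `v ∤ ℓ` the algebraic factor of the avatar is trivial on
`K_vˣ`). [cite: Weil1956, §2] [cite: SerreAbelianLadic1968, II §2.8] -/
theorem toWeilGroupHom_weilRep_apply_coe (ι : PadicAlgCl ℓ ≃+* ℂ)
    (hinf : θ.HasInfinityType p q) (hmod : HeckeCharacter.IsModulus θ T e)
    {v : HeightOneSpectrum (𝓞 K)} (hvℓ : ((ℓ : ℕ) : 𝓞 K) ∉ v.asIdeal)
    (a : WeilGroup (v.adicCompletion K) →* (v.adicCompletion K)ˣ)
    (ha : IsLocalArtinMap (v.adicCompletion K) a) (w : WeilGroup (v.adicCompletion K)) :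
    ((((hinf.weilRep hmod ι).toLocal v).toWeilGroupHom w : GL (Fin 1) (PadicAlgCl ℓ)) :
        Matrix (Fin 1) (Fin 1) (PadicAlgCl ℓ)) 0 0 = ι.symm (θ (localUnits v (a w)) : ℂ) := by
  have h := hinf.det_weilRep_toAbsGalois hmod ι
    (fun w hw => HeckeCharacter.isUnramifiedAt_of_isModulus' hmod hw) v a ha w
  have h' := congrArg (fun u : (PadicAlgCl ℓ)ˣ => (u : PadicAlgCl ℓ)) h
  simp only [FramedRep.det_apply, Matrix.GeneralLinearGroup.val_det_apply,
    Matrix.det_fin_one] at h'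
  rw [FramedRep.toWeilGroupHom_apply, FramedGaloisRep.toLocal_apply, h', hinf.lAdicAvatar_apply,
    HeckeCharacter.coe_lAdicAvatarHom_localUnits_of_not_mem ι hvℓ]

/-! ### §4 The local component `θ_v ∘ det` and local–global compatibility away from `ℓ` -/

/-- **The local component at `v` of an automorphic `π` of `GL₁/K` on which the ideles act through
`θ ∘ det` modulo `π.W'` is the character `θ_v ∘ det`**: for any `φ₀ ∈ π.W ∖ π.W'` the line
`z ↦ z • φ₀` is `GL₁(K_v)`-equivariant into `π.W / π.W'`. [cite: Flath1979, Thm 3]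
[cite: BorelJacquet1979, §4.6] -/
theorem hasLocalComponentAt_ofQuasiChar_of_heckeCharacter
    (π : AutomorphicRepData (AutomorphyDatum.gl 1 K hcpt))
    (hχ : ∀ (g : (AdelicGroupData.gl 1 K).Adelic), ∀ φ ∈ π.W,
      rightTranslation (AdelicGroupData.gl 1 K) g φ -
        ((θ (Matrix.GeneralLinearGroup.det g) : ℂˣ) : ℂ) • φ ∈ π.W')
    (v : HeightOneSpectrum (𝓞 K)) :
    π.HasLocalComponentAt v (SmoothIrrep.ofQuasiChar
      (⟨θ.localComponent v, θ.continuous_localComponent v⟩ :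
        QuasiChar (v.adicCompletion K))).ρ := by
  show π.HasLocalComponentAt v (V := ℂ) (glOneRep (θ.localComponent v))
  obtain ⟨φ₀, hφ₀W, hφ₀W'⟩ := SetLike.exists_of_lt π.lt
  refine ⟨LinearMap.toSpanSingleton ℂ _ φ₀, ?_, ?_, fun g x => ?_⟩
  · rintro _ ⟨c, rfl⟩
    rw [LinearMap.toSpanSingleton_apply]
    exact π.W.smul_mem c hφ₀W
  · intro h
    apply hφ₀W'
    have h1 := h (LinearMap.mem_range_self (LinearMap.toSpanSingleton ℂ _ φ₀) (1 : ℂ))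
    rwa [LinearMap.toSpanSingleton_apply, one_smul] at h1
  · have h := hχ (GLn.ofLocal 1 K v g) φ₀ hφ₀W
    rw [← detTwist_apply, detTwist_ofLocal] at h
    rw [glOneRep_apply, LinearMap.toSpanSingleton_apply, LinearMap.toSpanSingleton_apply, map_smul,
      mul_comm, mul_smul, ← smul_sub, ← neg_sub]
    exact π.W'.smul_mem x (π.W'.neg_mem h)

/-- **Local–global compatibility at every `v ∤ ℓ`, ramified places included.**  For `π` as above,
`LocalGlobalCompatibleAt 𝓡 ι π r_{θ,ι} v` holds: `π_v = θ_v ∘ det`; the Weil–Deligne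
representation attached to `r_{θ,ι}|W_{K_v}` by Grothendieck–Deligne is `(ι⁻¹θ_v ∘ Art_v, 0)`
(§1, §3), whose `ι`-transport `(θ_v ∘ Art_v, 0)` is `rec₁(θ_v ∘ det)` by local class field theory.
[cite: HarrisTaylorAMS2001, Thm A] [cite: TaylorGaloisRepresentations2004, Conj. 7]
[cite: DeligneAntwerpII1973, §8.4.2] -/
theorem localGlobalCompatibleAt_weilRep_away (𝓡 : ReciprocityData K) (ι : PadicAlgCl ℓ ≃+* ℂ)
    (π : AutomorphicRepData (AutomorphyDatum.gl 1 K hcpt))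
    (hχ : ∀ (g : (AdelicGroupData.gl 1 K).Adelic), ∀ φ ∈ π.W,
      rightTranslation (AdelicGroupData.gl 1 K) g φ -
        ((θ (Matrix.GeneralLinearGroup.det g) : ℂˣ) : ℂ) • φ ∈ π.W')
    (hinf : θ.HasInfinityType p q) (hmod : HeckeCharacter.IsModulus θ T e)
    {v : HeightOneSpectrum (𝓞 K)} (hv : ((ℓ : ℕ) : 𝓞 K) ∉ v.asIdeal) :
    LocalGlobalCompatibleAt 𝓡 ι π (hinf.weilRep hmod ι) v := by
  obtain ⟨r, hr⟩ := GrothendieckDeligne_exists_isWeilDeligneOfLadic.toLocal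
    GrothendieckDeligne_exists_isWeilDeligneOfLadic_holds K 1 ℓ (hinf.weilRep hmod ι) v hv
  set χv : QuasiChar (v.adicCompletion K) := ⟨θ.localComponent v, θ.continuous_localComponent v⟩
    with hχv
  refine ⟨SmoothIrrep.ofQuasiChar χv, r,
    WeilDeligneRep.ofQuasiCharOn (Fin 1 → ℂ) (𝓡.llc v).hns (𝓡.llc v).artin χv,
    hasLocalComponentAt_ofQuasiChar_of_heckeCharacter π hχ v, fun _ => hr, fun hv' => absurd hv' hv,
    ⟨fun w => ?_, ?_⟩, ?_⟩
  · rw [isWeilDeligneOfLadic_toMatrix'_ρ_eq_of_rank_one hr w]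
    have hℂ : (WeilDeligneRep.ofQuasiCharOn (Fin 1 → ℂ) (𝓡.llc v).hns (𝓡.llc v).artin χv).ρ w =
        ((χv ((𝓡.llc v).artin.artin w) : ℂˣ) : ℂ) • LinearMap.id :=
      LinearMap.ext fun x => rfl
    rw [hℂ, map_smul, LinearMap.toMatrix'_id]
    ext i j
    obtain rfl : i = 0 := Subsingleton.elim _ _
    obtain rfl : j = 0 := Subsingleton.elim _ _
    rw [Matrix.smul_apply, Matrix.one_apply_eq, smul_eq_mul, mul_one, Matrix.map_apply,
      toWeilGroupHom_weilRep_apply_coe ι hinf hmod hv _ (isLocalArtinMap_llc_artin 𝓡 v) w]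
    exact (ι.apply_symm_apply _).symm
  · rw [WeilDeligneRep.ofQuasiCharOn_N, weilDeligneRep_N_eq_zero_of_rank_one r, map_zero,
      map_zero, Matrix.map_zero _ (map_zero _)]
  · rw [recGL_one_ofQuasiChar]
    exact (WeilDeligneRep.isFrobSemisimple_ofQuasiCharOn _ _ _).hasFrobSemisimpleClass

/-- At `v ∣ ℓ` the automorphic half of local–global compatibility is proved (`π_v = θ_v ∘ det`,
target class `[(θ_v ∘ Art_v, 0)]`); what remains is a statement about the pinned datum
`𝓡.pst ℓ v hv` on `r_{θ,ι}|Γ_{K_v}`. [cite: BuzzardGeeLMS2014, Rem. 3.2.5]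
[cite: FontaineAsterisque223VIII, §2.3.7] -/
theorem localGlobalCompatibleAt_weilRep_of_pst (𝓡 : ReciprocityData K) (ι : PadicAlgCl ℓ ≃+* ℂ)
    (π : AutomorphicRepData (AutomorphyDatum.gl 1 K hcpt))
    (hχ : ∀ (g : (AdelicGroupData.gl 1 K).Adelic), ∀ φ ∈ π.W,
      rightTranslation (AdelicGroupData.gl 1 K) g φ -
        ((θ (Matrix.GeneralLinearGroup.det g) : ℂˣ) : ℂ) • φ ∈ π.W')
    (hinf : θ.HasInfinityType p q) (hmod : HeckeCharacter.IsModulus θ T e)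
    {v : HeightOneSpectrum (𝓞 K)} (hv : ((ℓ : ℕ) : 𝓞 K) ∈ v.asIdeal)
    (hpst : ∃ (r : WeilDeligneRep (v.adicCompletion K) (PadicAlgCl ℓ) (Fin 1 → PadicAlgCl ℓ))
        (rℂ : WeilDeligneRep (v.adicCompletion K) ℂ (Fin 1 → ℂ)),
      (𝓡.pst ℓ v hv).IsWeilDeligneOf ((hinf.weilRep hmod ι).toLocal v) r ∧
        r.IsTransportAlong (ι : PadicAlgCl ℓ →+* ℂ) rℂ ∧
        rℂ.HasFrobSemisimpleClass ((𝓡.llc v).recGL 1 (IrrClass.mk (SmoothIrrep.ofQuasiChar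
          (⟨θ.localComponent v, θ.continuous_localComponent v⟩ :
            QuasiChar (v.adicCompletion K)))))) :
    LocalGlobalCompatibleAt 𝓡 ι π (hinf.weilRep hmod ι) v := by
  obtain ⟨r, rℂ, hr, htr, hcl⟩ := hpst
  exact ⟨_, r, rℂ, hasLocalComponentAt_ofQuasiChar_of_heckeCharacter π hχ v,
    fun hv' => absurd hv hv', fun _ => hr, htr, hcl⟩

/-! ### §5 Clause (A) for `GL₁` ⟺ the pinned datum on Weil's characters -/

/-- **Clause (A) of the summit for `n = 1`, decided up to the pinned Fontaine datum.**
`AutomorphicToGalois 1 𝓡 hcpt` holds iff for every algebraic Hecke character `θ` of `K` (any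
infinity-type witness `hinf`, any modulus of definition `(T, e)`),
every `ℓ`, `ι : ℚ̄_ℓ ≃ ℂ` and every `v ∣ ℓ`, the datum `𝓡.pst ℓ v hv`
(= `fontainePstAdicCompletion v ℓ hv`) declares Weil's character `r_{θ,ι}|Γ_{K_v}` de Rham and
attaches to it a Weil–Deligne representation whose `ι`-transport has class `[(θ_v ∘ Art_v, 0)]`.
(→): run (A) on the cuspidal `θ ∘ det` [Borel–Jacquet §4.6], which is `L`-algebraic [Clozel;
Λ17], identify its partner with `r_{θ,ι}` (§2) and unfold local–global compatibility at `v ∣ ℓ`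
via Λ20.  (←): every `L`-algebraic cuspidal `π` of `GL₁` is `θ ∘ det` for an algebraic `θ`
[Weil 1956; Clozel §1.2, §3.5 — `GL₁` is odd so `L`- = `C`-algebraic]; take `ρ := r_{θ,ι}` and
use §§2–4. [cite: BuzzardGeeLMS2014, Conj. 3.2.1, Conj. 3.2.2, Rem. 3.2.5]
[cite: Weil1956, §§1–2] [cite: SerreAbelianLadic1968, III §2.3]
[cite: FontaineAsterisque223VIII, §2.3.7] [cite: Conrad2011LiftingGlobal, App. B.4] -/
theorem automorphicToGalois_one_iff_pst (𝓡 : ReciprocityData K) :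
    AutomorphicToGalois 1 𝓡 hcpt ↔
      ∀ (θ : HeckeCharacter K) (p q : InfinitePlace K → ℤ) (hinf : θ.HasInfinityType p q)
        (T : Finset (HeightOneSpectrum (𝓞 K))) (e : HeightOneSpectrum (𝓞 K) → ℕ)
        (hmod : HeckeCharacter.IsModulus θ T e) (ℓ : ℕ) [Fact ℓ.Prime] (ι : PadicAlgCl ℓ ≃+* ℂ)
        (v : HeightOneSpectrum (𝓞 K)) (hv : ((ℓ : ℕ) : 𝓞 K) ∈ v.asIdeal),
        (𝓡.pst ℓ v hv).IsDeRhamFramed ((hinf.weilRep hmod ι).toLocal v) ∧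
          ∃ (r : WeilDeligneRep (v.adicCompletion K) (PadicAlgCl ℓ) (Fin 1 → PadicAlgCl ℓ))
            (rℂ : WeilDeligneRep (v.adicCompletion K) ℂ (Fin 1 → ℂ)),
            (𝓡.pst ℓ v hv).IsWeilDeligneOf ((hinf.weilRep hmod ι).toLocal v) r ∧
              r.IsTransportAlong (ι : PadicAlgCl ℓ →+* ℂ) rℂ ∧
              rℂ.HasFrobSemisimpleClass
                ((𝓡.llc v).recGL 1 (IrrClass.mk (SmoothIrrep.ofQuasiChar
                  (⟨θ.localComponent v, θ.continuous_localComponent v⟩ :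
                    QuasiChar (v.adicCompletion K))))) := by
  constructor
  · intro hA θ p q hinf T e hmod ℓ _ ι v hv
    obtain ⟨π, hW, hW'⟩ := exists_cuspidal_detTwist_glOne hcpt θ
    have hχ := heckeCharacter_detTwist_glOne hW
    obtain ⟨ρ, -, hgeo, hcor, -⟩ :=
      hA π (isLAlgebraic_of_hasInfinityType_heckeCharacter_glOne π.1 hχ hinf) ℓ ι
    obtain rfl : ρ = hinf.weilRep hmod ι := eq_weilRep_of_corresponds 𝓡 ι π.1 hχ hinf hmod hcor
    refine ⟨hgeo.2 v hv, ?_⟩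
    obtain ⟨πv, r, rℂ, hπv, -, h₂, h₃, h₄⟩ := hcor.2 v
    rw [irrClass_eq_ofQuasiChar_of_hasLocalComponentAt θ hW hW' hπv] at h₄
    exact ⟨r, rℂ, h₂ hv, h₃, h₄⟩
  · intro h
    rw [automorphicToGalois_one_iff 𝓡]
    intro π hπ ℓ _ ι
    obtain ⟨θ, hχ⟩ := π.1.exists_heckeCharacter_glOne
    obtain ⟨T₀, hT₀, hL⟩ := hπ
    obtain ⟨p, q, hinf⟩ := π.1.exists_hasInfinityType_heckeCharacter_glOne hχ hT₀
      ((InfinityType.isCAlgebraic_iff_isLAlgebraic_of_odd odd_one T₀).mpr hL)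
    obtain ⟨T, e, hmod⟩ := θ.exists_isModulus
    refine ⟨hinf.weilRep hmod ι, (isGeometricFramed_weilRep_iff 𝓡 ι hinf hmod).mpr
      fun v hv => (h θ p q hinf T e hmod ℓ ι v hv).1,
      eventually_satakeFrobCompatibleAt_weilRep ι π.1 hχ hinf hmod, fun v => ?_⟩
    by_cases hv : ((ℓ : ℕ) : 𝓞 K) ∈ v.asIdeal
    · exact localGlobalCompatibleAt_weilRep_of_pst 𝓡 ι π.1 hχ hinf hmod hv
        (h θ p q hinf T e hmod ℓ ι v hv).2
    · exact localGlobalCompatibleAt_weilRep_away 𝓡 ι π.1 hχ hinf hmod hv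

/-- Corollary: under clause (A) for `GL₁`, the pinned datum declares every Weil character
`r_{θ,ι}|Γ_{K_v}` (`v ∣ ℓ`) de Rham with Weil–Deligne class `[(θ_v ∘ Art_v, 0)]` — the two
properties of `fontainePstAdicCompletion` that clause (A) *asserts* rather than proves.
[cite: BuzzardGeeLMS2014, Rem. 3.2.5] [cite: FontaineMazurGeometric1995, §1] -/
theorem pst_weilRep_of_automorphicToGalois (𝓡 : ReciprocityData K)
    (hA : AutomorphicToGalois 1 𝓡 hcpt) (hinf : θ.HasInfinityType p q)
    (hmod : HeckeCharacter.IsModulus θ T e) (ι : PadicAlgCl ℓ ≃+* ℂ)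
    (v : HeightOneSpectrum (𝓞 K)) (hv : ((ℓ : ℕ) : 𝓞 K) ∈ v.asIdeal) :
    (𝓡.pst ℓ v hv).IsDeRhamFramed ((hinf.weilRep hmod ι).toLocal v) ∧
      ∃ (r : WeilDeligneRep (v.adicCompletion K) (PadicAlgCl ℓ) (Fin 1 → PadicAlgCl ℓ))
        (rℂ : WeilDeligneRep (v.adicCompletion K) ℂ (Fin 1 → ℂ)),
        (𝓡.pst ℓ v hv).IsWeilDeligneOf ((hinf.weilRep hmod ι).toLocal v) r ∧
          r.IsTransportAlong (ι : PadicAlgCl ℓ →+* ℂ) rℂ ∧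
          rℂ.HasFrobSemisimpleClass
            ((𝓡.llc v).recGL 1 (IrrClass.mk (SmoothIrrep.ofQuasiChar
              (⟨θ.localComponent v, θ.continuous_localComponent v⟩ :
                QuasiChar (v.adicCompletion K))))) :=
  (automorphicToGalois_one_iff_pst 𝓡).mp hA θ p q hinf T e hmod ℓ ι v hv

end Avatar

end GLOneRigidity

end Summit.Langlands.Langlands.Theorems
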